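import Literature.AnabelianGeometry.AbsoluteAnabelian.NeukirchUchidaCoreAssembly
import Literature.AnabelianGeometry.AbsoluteAnabelian.NeukirchUchidaLevelConjugacy
import Literature.AnabelianGeometry.AbsoluteAnabelian.NeukirchUchidaGaloisInvariance
import Literature.AnabelianGeometry.AbsoluteAnabelian.NeukirchUchidaReduction
import Literature.AnabelianGeometry.AbsoluteAnabelian.NeukirchUchidaTransportToF
import HarnessLib

/-!
# The Neukirch–Uchida deduction: the `ℚ`-core assembled — kernel skeleton of the whole chain

J. Neukirch, A. Schmidt, K. Wingberg, *Cohomology of Number Fields* (2nd ed.), Thm. (12.2.1)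
(Neukirch–Uchida: «the natural map `Isom(F̄₂/F₂, F̄₁/F₁) → Isom(G_{F₁}, G_{F₂})` is bijective», as quoted
in [AbsAnab] Thm. 1.1.3), in the one-closure model over `Ω₀ = ℚ̄`, `Γ = G_ℚ = Field.absoluteGaloisGroup ℚ`.
This file is the ASSEMBLY of the abc-iut sub-DAG `plan/L4/SUBDAG-NeukirchUchida.md` (GAP-LEDGER row
G-L4d2g4-1): it composes the landed rows

* R1 prime correspondence (`NeukirchUchidaPrimeCorrespondence`), R6 Galois invariance
  (`NeukirchUchidaGaloisInvariance`, abc-iut-w6-d108), R9 Kummer separation / R10 level conjugator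
  (`NeukirchUchidaKummerSeparation`, `NeukirchUchidaLevelConjugacy`), R11 compactness + R7 slimness
  (`NeukirchUchidaCoreAssembly`, `Literature.GroupTheory.LevelwiseConjugacyLimit` of abc-iut-w6-d055,
  `NeukirchUchidaReduction` of abc-iut-w6-d108), R0 transport (`ΓK`, `KV`, abc-iut-w6-d055) and R12
  (`neukirchUchida_of_ratCore`, abc-iut-w6-d055)

into:

* `existsUnique_forall_eq_conj_of_rows` — **the `ℚ`-core**: for `α : U₁ ⥲ U₂` (open subgroups of `Γ`), a
  finite Galois `N` with `Γ_N ≤ U₁`, the row-R4 data at `Γ_N` and the separation oracle at every Galois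
  `M ⊇ N`, there is a UNIQUE `τ ∈ Γ` with `α(u) = τ u τ⁻¹` on `U₁`;
* `neukirchUchida_of_rows` — **`NeukirchUchida F` for every number field `F`** (the tree's named fact,
  p437013) from (12.1.9) at base `ℚ` and the row-data producer.

What is NOT done here (named, not hidden): the two DISCHARGERS of the row data from (12.1.9) — row R4
(degrees and degree-one primes from R1 + R2 + R3) and «R10b» (the separation oracle from R9 + R3 + R8 + R6)
— and (12.1.9) itself (abc-iut-w5-d055's row).  PROOF-ONLY (0 `def`s).  HONEST FRAMING: classical,
outside the [IUTchIII] Cor. 3.12 cone; nothing here takes a side; typed ≠ proved for the hypotheses.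

## References
* [NeukirchSchmidtWingberg2008] Neukirch–Schmidt–Wingberg, *Cohomology of Number Fields*, Thm. (12.2.1).
* [MochizukiAbsAnab2004] S. Mochizuki, *The absolute anabelian geometry of hyperbolic curves*, Thm. 1.1.3 p. 6.
* [NeukirchANT1999] J. Neukirch, *Algebraic Number Theory*, Ch. IV §1 (infinite Galois theory).
-/

noncomputable section

open scoped Pointwise NumberField
open Field IsDedekindDomain

namespace Literature.AnabelianGeometry.AbsoluteAnabelian

namespace NeukirchUchidaProof

variable {U₁ U₂ : Subgroup (absoluteGaloisGroup ℚ)}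

/-- **Restriction of the prime correspondence to an invariant subgroup**: if `α(D_A ∩ U₁) = D_B ∩ U₂`,
`α(H ∩ U₁) = H ∩ U₂` for `H ≤ U₁ ∩ U₂`, and `α_H : H ⥲ H` has the values of `α`, then
`α_H(D_A ∩ H) = D_B ∩ H`. [cite: NeukirchSchmidtWingberg2008, Thm (12.2.1)] -/
theorem map_stabilizer_subgroupOf_restrict (α : U₁ ≃* U₂) {H : Subgroup (absoluteGaloisGroup ℚ)}
    (hH₁ : H ≤ U₁) (hαH : (H.subgroupOf U₁).map α.toMonoidHom = H.subgroupOf U₂) (αH : H ≃* H)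
    (hαHv : ∀ h : H, ((αH h : H) : absoluteGaloisGroup ℚ) =
      ((α ⟨(h : absoluteGaloisGroup ℚ), hH₁ h.2⟩ : U₂) : absoluteGaloisGroup ℚ))
    {A B : ValuationSubring (AlgebraicClosure ℚ)}
    (hAB : ((MulAction.stabilizer (absoluteGaloisGroup ℚ) A).subgroupOf U₁).map α.toMonoidHom =
      (MulAction.stabilizer (absoluteGaloisGroup ℚ) B).subgroupOf U₂) :
    ((MulAction.stabilizer (absoluteGaloisGroup ℚ) A).subgroupOf H).map αH.toMonoidHom =
      (MulAction.stabilizer (absoluteGaloisGroup ℚ) B).subgroupOf H := by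
  ext v
  constructor
  · rintro ⟨u, hu, rfl⟩
    change ((αH u : H) : absoluteGaloisGroup ℚ) ∈ MulAction.stabilizer (absoluteGaloisGroup ℚ) B
    rw [hαHv]
    have : α ⟨(u : absoluteGaloisGroup ℚ), hH₁ u.2⟩ ∈
        ((MulAction.stabilizer (absoluteGaloisGroup ℚ) A).subgroupOf U₁).map α.toMonoidHom :=
      ⟨⟨(u : absoluteGaloisGroup ℚ), hH₁ u.2⟩, hu, rfl⟩
    rw [hAB] at this
    exact this
  · intro hv
    -- `α⁻¹ v ∈ D_A ∩ H`
    have hvU₂ : (v : absoluteGaloisGroup ℚ) ∈ U₂ := by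
      have : αH (αH.symm v) = v := αH.apply_symm_apply v
      have h2 := hαHv (αH.symm v)
      rw [this] at h2
      rw [h2]
      exact (α _).2
    have hmem : (⟨(v : absoluteGaloisGroup ℚ), hvU₂⟩ : U₂) ∈
        ((MulAction.stabilizer (absoluteGaloisGroup ℚ) A).subgroupOf U₁).map α.toMonoidHom := by
      rw [hAB]
      exact hv
    obtain ⟨u, hu, huv⟩ := hmem
    -- `u ∈ H` since `α u = v ∈ H` and `α(H) = H`
    have huH : (u : absoluteGaloisGroup ℚ) ∈ H := by
      have : α u ∈ H.subgroupOf U₂ := by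
        rw [MulEquiv.coe_toMonoidHom] at huv
        rw [huv]
        exact v.2
      rw [← hαH] at this
      obtain ⟨u', hu', hu'u⟩ := this
      rw [MulEquiv.coe_toMonoidHom] at hu'u
      have : u' = u := α.injective hu'u
      exact this ▸ hu'
    refine ⟨⟨(u : absoluteGaloisGroup ℚ), huH⟩, hu, ?_⟩
    apply Subtype.ext
    rw [MulEquiv.coe_toMonoidHom, hαHv]
    have e : (⟨((⟨(u : absoluteGaloisGroup ℚ), huH⟩ : H) : absoluteGaloisGroup ℚ), hH₁ huH⟩ : U₁) = u :=
      Subtype.ext rfl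
    rw [e]
    rw [MulEquiv.coe_toMonoidHom] at huv
    exact congrArg Subtype.val huv

/-- **A finite Galois level above `N` inside an open subgroup**: for `N/ℚ` finite inside `ℚ̄` and an
open `W ≤ Γ` there is a finite Galois `M ⊇ N` inside `ℚ̄` with `Γ_M ≤ W` (adjoin a `ℚ`-basis of `N`
to the set generating a Galois level below `W`). [cite: NeukirchSchmidtWingberg2008, Thm (12.2.1)] -/
theorem exists_isGalois_ge_ΓK_le (N : IntermediateField ℚ (AlgebraicClosure ℚ)) [FiniteDimensional ℚ N]
    (W : Subgroup (absoluteGaloisGroup ℚ)) (hW : IsOpen (W : Set (absoluteGaloisGroup ℚ))) :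
    ∃ M : IntermediateField ℚ (AlgebraicClosure ℚ), FiniteDimensional ℚ M ∧ IsGalois ℚ M ∧
      N ≤ M ∧ ΓK M ≤ W := by
  classical
  let b := Module.finBasis ℚ N
  let S : Set (AlgebraicClosure ℚ) := Set.range fun i => ((b i : N) : AlgebraicClosure ℚ)
  have hS : S.Finite := Set.finite_range _
  obtain ⟨M, hMfin, hMgal, hSM, hMW⟩ := exists_isGalois_subset_ΓK_le W hW S hS
  refine ⟨M, hMfin, hMgal, fun x hx => ?_, hMW⟩
  -- `x = Σ cᵢ bᵢ ∈ M`
  have hx' : ((⟨x, hx⟩ : N) : AlgebraicClosure ℚ) ∈ M := by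
    rw [← b.sum_repr ⟨x, hx⟩]
    push_cast
    refine M.sum_mem fun i _ => ?_
    exact M.smul_mem (hSM ⟨i, rfl⟩)
  exact hx'

/-- `Γ_M ⊴ Γ` for `M/ℚ` finite Galois inside `ℚ̄` (Mathlib's `IsGalois.fixingSubgroup_normal_of_isGalois`,
read in `Γ`; the `ℚ`-algebra instances are handed over explicitly). [cite: NeukirchANT1999, Ch. IV §1] -/
theorem normal_ΓK (M : IntermediateField ℚ (AlgebraicClosure ℚ)) (hM : IsGalois ℚ M) : (ΓK M).Normal := by
  haveI : IsAlgClosure ℚ (AlgebraicClosure ℚ) :=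
    ⟨AlgebraicClosure.isAlgClosed ℚ, AlgebraicClosure.isAlgebraic ℚ⟩
  have hn : M.fixingSubgroup.Normal :=
    @IsGalois.fixingSubgroup_normal_of_isGalois ℚ (AlgebraicClosure ℚ) _ _ _ M
      (IsAlgClosure.isGalois ℚ (AlgebraicClosure ℚ)) hM
  rw [ΓK_eq_comap]
  exact hn.comap _

/-- From the subgroup form `α_H(D_A ∩ H) = D_B ∩ H` to the elementwise form «`g ∈ D_A ↔ α(g) ∈ D_B` for
`g ∈ H`». [cite: NeukirchSchmidtWingberg2008, Thm (12.2.1)] -/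
theorem mem_stabilizer_iff_of_map_restrict (α : U₁ ≃* U₂) {H : Subgroup (absoluteGaloisGroup ℚ)}
    (hH₁ : H ≤ U₁) (αH : H ≃* H)
    (hαHv : ∀ h : H, ((αH h : H) : absoluteGaloisGroup ℚ) =
      ((α ⟨(h : absoluteGaloisGroup ℚ), hH₁ h.2⟩ : U₂) : absoluteGaloisGroup ℚ))
    {A B : ValuationSubring (AlgebraicClosure ℚ)}
    (h : ((MulAction.stabilizer (absoluteGaloisGroup ℚ) A).subgroupOf H).map αH.toMonoidHom =
      (MulAction.stabilizer (absoluteGaloisGroup ℚ) B).subgroupOf H)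
    (g : absoluteGaloisGroup ℚ) (hg : g ∈ H) :
    g ∈ MulAction.stabilizer (absoluteGaloisGroup ℚ) A ↔
      ((α ⟨g, hH₁ hg⟩ : U₂) : absoluteGaloisGroup ℚ) ∈ MulAction.stabilizer (absoluteGaloisGroup ℚ) B := by
  have hv : ((α ⟨g, hH₁ hg⟩ : U₂) : absoluteGaloisGroup ℚ) = ((αH ⟨g, hg⟩ : H) : absoluteGaloisGroup ℚ) :=
    (hαHv ⟨g, hg⟩).symm
  rw [hv]
  constructor
  · intro hgA
    have : αH ⟨g, hg⟩ ∈ ((MulAction.stabilizer (absoluteGaloisGroup ℚ) A).subgroupOf H).map αH.toMonoidHom :=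
      ⟨⟨g, hg⟩, hgA, rfl⟩
    rw [h] at this
    exact this
  · intro hgB
    have : αH ⟨g, hg⟩ ∈ (MulAction.stabilizer (absoluteGaloisGroup ℚ) B).subgroupOf H := hgB
    rw [← h] at this
    obtain ⟨g', hg', hgg'⟩ := this
    rw [MulEquiv.coe_toMonoidHom] at hgg'
    have : g' = ⟨g, hg⟩ := αH.injective hgg'
    rw [this] at hg'
    exact hg'

/-- **THE `ℚ`-CORE OF NEUKIRCH–UCHIDA, assembled** ([NSW] (12.2.1) in the one-closure model over
`Ω₀ = ℚ̄`, `Γ = G_ℚ`; kernel skeleton of `plan/L4/SUBDAG-NeukirchUchida.md`).  INPUTS: `α : U₁ ⥲ U₂` a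
topological isomorphism of open subgroups of `Γ`; a finite Galois `N/ℚ` inside `ℚ̄` with `Γ_N ≤ U₁`
(row R7 (b), `exists_isGalois_subset_ΓK_le`); (`hdeg`, `hP₁`) = row R4 OUT at `V = Γ_N` (equal degrees and
degree-one transfer for the fixed fields of `Γ_N` and `α(Γ_N)`; from the prime correspondence R1 + local
invariants R2 + the dictionary R3); (`hsep`) = the SEPARATION ORACLE at every finite Galois `M ⊇ N`
(row R9 `inv_mul_mem_of_map_stabilizer_eq` at base `Γ_M` fed with the Chinese-remainder/Kummer/Frobenius
data of rows R3/R8 and the invariance `α(Γ_M) = Γ_M` of row R6, restricted from `Γ_N`).  OUTPUT: a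
UNIQUE `τ ∈ Γ` with `α(u) = τ u τ⁻¹` for all `u ∈ U₁`.  Chain: R6 (`map_ΓK_subgroupOf_eq_of_KV_of_continuousMulEquiv`,
abc-iut-w6-d108) gives `α(Γ_N) = Γ_N`, hence the restriction `α_N` (`exists_mulEquiv_restrict`); for each
open normal `W ≤ Γ_N` pick a Galois `M ⊇ N` with `Γ_M ≤ W` (`exists_isGalois_ge_ΓK_le`); the oracle and R10
(`levelConjugator_of_separation`) give a conjugator modulo `Γ_M ≤ W`; R11 + R7
(`existsUnique_forall_eq_conj_of_levelwise`: compactness + slimness) finish.  (12.1.9) enters only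
through `hdeg`/`hP₁`/`hsep`'s dischargers (via R1), not here.
[cite: NeukirchSchmidtWingberg2008, Thm (12.2.1)] -/
theorem existsUnique_forall_eq_conj_of_rows (hU₁ : IsOpen (U₁ : Set (absoluteGaloisGroup ℚ)))
    (α : U₁ ≃ₜ* U₂) (N : IntermediateField ℚ (AlgebraicClosure ℚ)) [FiniteDimensional ℚ N]
    [hNgal : IsGalois ℚ N] (hNU : ΓK N ≤ U₁)
    (hdeg : Module.finrank ℚ (KV (ΓK N)) = Module.finrank ℚ
      (KV ((((ΓK N).subgroupOf U₁).map α.toMulEquiv.toMonoidHom).map U₂.subtype)))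
    (hP₁ : ∀ v₀ : HeightOneSpectrum (𝓞 ℚ),
      (∃ P' ∈ v₀.asIdeal.primesOver
          (𝓞 (KV ((((ΓK N).subgroupOf U₁).map α.toMulEquiv.toMonoidHom).map U₂.subtype))),
          P'.ramificationIdx (𝓞 ℚ) = 1 ∧ P'.inertiaDeg (𝓞 ℚ) = 1) →
        ∃ P ∈ v₀.asIdeal.primesOver (𝓞 (KV (ΓK N))),
          P.ramificationIdx (𝓞 ℚ) = 1 ∧ P.inertiaDeg (𝓞 ℚ) = 1)
    (hsep : ∀ M : IntermediateField ℚ (AlgebraicClosure ℚ), FiniteDimensional ℚ M → IsGalois ℚ M →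
      N ≤ M → ∃ (A₀ : ValuationSubring (AlgebraicClosure ℚ)) (m₀ m₁ : absoluteGaloisGroup ℚ),
        ((MulAction.stabilizer (absoluteGaloisGroup ℚ) A₀).subgroupOf U₁).map α.toMulEquiv.toMonoidHom =
          (MulAction.stabilizer (absoluteGaloisGroup ℚ) (m₀ • A₀)).subgroupOf U₂ ∧
        ∀ (a : absoluteGaloisGroup ℚ) (_ : a ∈ ΓK N) (m : absoluteGaloisGroup ℚ),
          (∀ (g : absoluteGaloisGroup ℚ) (hg : g ∈ ΓK N),
            g ∈ MulAction.stabilizer (absoluteGaloisGroup ℚ) (a • A₀) ↔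
              ((α ⟨g, hNU hg⟩ : U₂) : absoluteGaloisGroup ℚ) ∈
                MulAction.stabilizer (absoluteGaloisGroup ℚ) (m • a • A₀)) →
          m⁻¹ * m₁ ∈ ΓK M) :
    ∃! τ : absoluteGaloisGroup ℚ, ∀ u : U₁, ((α u : U₂) : absoluteGaloisGroup ℚ) = τ * u * τ⁻¹ := by
  -- R6 at `N`: `α(Γ_N) = Γ_N`, `Γ_N ≤ U₂`
  obtain ⟨hαH, hHU₂⟩ := map_ΓK_subgroupOf_eq_of_KV_of_continuousMulEquiv α N hNU _ rfl hdeg hP₁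
  -- the restricted automorphism `α_N` of `H = Γ_N`
  obtain ⟨αH, hαHv⟩ := exists_mulEquiv_restrict α.toMulEquiv (ΓK N) hNU hHU₂ hαH
  have hHn : (ΓK N).Normal := normal_ΓK N hNgal
  refine existsUnique_forall_eq_conj_of_levelwise U₁ U₂ hU₁ α.toMulEquiv (ΓK N) (isOpen_ΓK N) hHn
    hNU ?_
  -- the level-wise conjugators
  intro W hWopen _ hWH
  obtain ⟨M, hMfin, hMgal, hNM, hMW⟩ := exists_isGalois_ge_ΓK_le N W hWopen
  obtain ⟨A₀, m₀, m₁, hπ₀, hor⟩ := hsep M hMfin hMgal hNM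
  haveI : (ΓK M).Normal := normal_ΓK M hMgal
  -- row R10 at `V = Γ_N`, `W = Γ_M`
  have hπ₀' := map_stabilizer_subgroupOf_restrict α.toMulEquiv hNU hαH αH hαHv hπ₀
  have hconj : ∀ a : ΓK N, ((αH a : ΓK N) : absoluteGaloisGroup ℚ)⁻¹ * (m₀ * a * m₀⁻¹) ∈ ΓK M := by
    refine levelConjugator_of_separation (V := ΓK N) (W := ΓK M) (m₁ := m₁) αH hπ₀' fun a m hcorr => ?_
    refine hor a a.2 m fun g hg => ?_
    exact mem_stabilizer_iff_of_map_restrict α.toMulEquiv hNU αH hαHv hcorr g hg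
  refine ⟨m₀, fun a ha => hMW ?_⟩
  have h := hconj ⟨a, ha⟩
  rw [hαHv ⟨a, ha⟩] at h
  exact h

/-- **Neukirch–Uchida for every number field, modulo (12.1.9) and the row-data producers.**  For
`Γ = G_ℚ` let (H β) be the (12.1.9) containment for `β : V₁ ⥲ V₂` (row R1's binder).  HYPOTHESES:
`h1219` — (12.1.9) at base `ℚ` for every such `β` (abc-iut-w5-d055's row); `hrows` — for every `β`
satisfying (H) and (H⁻¹), the ROW DATA of `existsUnique_forall_eq_conj_of_rows`: a finite Galois `N` with
`Γ_N ≤ V₁`, the degree/degree-one comparison at `Γ_N` (row R4) and the separation oracle at every Galois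
`M ⊇ N` (row R9 fed by R3/R8/R6 — the «R10b» discharger).  CONCLUSION: the named fact
`Literature.NumberTheory.GaloisRepresentations.NeukirchUchida F` (p437013) for EVERY number field `F`, through
abc-iut-w6-d055's transport `neukirchUchida_of_ratCore` (row R12).  This is the kernel-checked skeleton of
the whole sub-DAG: what remains is to DISCHARGE `hrows` from (H) (rows R4, R10b).
[cite: NeukirchSchmidtWingberg2008, Thm (12.2.1)] [cite: MochizukiAbsAnab2004, Thm 1.1.3 p.6] -/
theorem neukirchUchida_of_rows
    (h1219 : ∀ (V₁ V₂ : Subgroup (absoluteGaloisGroup ℚ)), IsOpen (V₁ : Set (absoluteGaloisGroup ℚ)) →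
      IsOpen (V₂ : Set (absoluteGaloisGroup ℚ)) → ∀ β : V₁ ≃ₜ* V₂,
      ∀ A : ValuationSubring (AlgebraicClosure ℚ), A ≠ ⊤ →
        ∃ B : ValuationSubring (AlgebraicClosure ℚ), B ≠ ⊤ ∧
          ((MulAction.stabilizer (absoluteGaloisGroup ℚ) A).subgroupOf V₁).map β.toMulEquiv.toMonoidHom ≤
            (MulAction.stabilizer (absoluteGaloisGroup ℚ) B).subgroupOf V₂)
    (hrows : ∀ (V₁ V₂ : Subgroup (absoluteGaloisGroup ℚ)), IsOpen (V₁ : Set (absoluteGaloisGroup ℚ)) →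
      IsOpen (V₂ : Set (absoluteGaloisGroup ℚ)) → ∀ β : V₁ ≃ₜ* V₂,
      (∀ A : ValuationSubring (AlgebraicClosure ℚ), A ≠ ⊤ →
        ∃ B : ValuationSubring (AlgebraicClosure ℚ), B ≠ ⊤ ∧
          ((MulAction.stabilizer (absoluteGaloisGroup ℚ) A).subgroupOf V₁).map β.toMulEquiv.toMonoidHom ≤
            (MulAction.stabilizer (absoluteGaloisGroup ℚ) B).subgroupOf V₂) →
      (∀ B : ValuationSubring (AlgebraicClosure ℚ), B ≠ ⊤ →
        ∃ A : ValuationSubring (AlgebraicClosure ℚ), A ≠ ⊤ ∧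
          ((MulAction.stabilizer (absoluteGaloisGroup ℚ) B).subgroupOf V₂).map β.toMulEquiv.symm.toMonoidHom ≤
            (MulAction.stabilizer (absoluteGaloisGroup ℚ) A).subgroupOf V₁) →
      ∃ (N : IntermediateField ℚ (AlgebraicClosure ℚ)) (_ : FiniteDimensional ℚ N) (_ : IsGalois ℚ N)
        (hNV : ΓK N ≤ V₁),
        Module.finrank ℚ (KV (ΓK N)) = Module.finrank ℚ
          (KV ((((ΓK N).subgroupOf V₁).map β.toMulEquiv.toMonoidHom).map V₂.subtype)) ∧
        (∀ v₀ : HeightOneSpectrum (𝓞 ℚ),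
          (∃ P' ∈ v₀.asIdeal.primesOver
              (𝓞 (KV ((((ΓK N).subgroupOf V₁).map β.toMulEquiv.toMonoidHom).map V₂.subtype))),
              P'.ramificationIdx (𝓞 ℚ) = 1 ∧ P'.inertiaDeg (𝓞 ℚ) = 1) →
            ∃ P ∈ v₀.asIdeal.primesOver (𝓞 (KV (ΓK N))),
              P.ramificationIdx (𝓞 ℚ) = 1 ∧ P.inertiaDeg (𝓞 ℚ) = 1) ∧
        (∀ M : IntermediateField ℚ (AlgebraicClosure ℚ), FiniteDimensional ℚ M → IsGalois ℚ M →
          N ≤ M → ∃ (A₀ : ValuationSubring (AlgebraicClosure ℚ)) (m₀ m₁ : absoluteGaloisGroup ℚ),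
            ((MulAction.stabilizer (absoluteGaloisGroup ℚ) A₀).subgroupOf V₁).map β.toMulEquiv.toMonoidHom =
              (MulAction.stabilizer (absoluteGaloisGroup ℚ) (m₀ • A₀)).subgroupOf V₂ ∧
            ∀ (a : absoluteGaloisGroup ℚ) (_ : a ∈ ΓK N) (m : absoluteGaloisGroup ℚ),
              (∀ (g : absoluteGaloisGroup ℚ) (hg : g ∈ ΓK N),
                g ∈ MulAction.stabilizer (absoluteGaloisGroup ℚ) (a • A₀) ↔
                  ((β ⟨g, hNV hg⟩ : V₂) : absoluteGaloisGroup ℚ) ∈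
                    MulAction.stabilizer (absoluteGaloisGroup ℚ) (m • a • A₀)) →
              m⁻¹ * m₁ ∈ ΓK M))
    (F : Type) [Field F] [NumberField F] :
    Literature.NumberTheory.GaloisRepresentations.NeukirchUchida F := by
  refine neukirchUchida_of_ratCore h1219 (fun V₁ V₂ hV₁ hV₂ β hβ hβ' => ?_) F
  obtain ⟨N, hNfin, hNgal, hNV, hdeg, hP₁, hsep⟩ := hrows V₁ V₂ hV₁ hV₂ β hβ hβ'
  haveI := hNfin
  haveI := hNgal
  obtain ⟨τ, hτ, -⟩ := existsUnique_forall_eq_conj_of_rows hV₁ β N hNV hdeg hP₁ hsep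
  exact ⟨τ, hτ⟩

end NeukirchUchidaProof

end Literature.AnabelianGeometry.AbsoluteAnabelian

end
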